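import Summits.AtomisticToContinuum.HydrodynamicLimit.Theorems.AntiMazurCoboundariesKineticFluxLdDecayHTheoremObjectsB
import Summits.AtomisticToContinuum.HydrodynamicLimit.Theorems.AntiMazurCoboundariesKineticFluxLdDecayVelocityEntropyBudget
import Literature.MathematicalPhysics.KineticTheory.HardSphereMeanCollisionCount
import HarnessLib

/-!
# Position tail budget for the crux line `h-theorem-dissipation-budget` (crux `KineticFluxLdDecay`,
# stmt-AtomisticToContinuum-10967) — registered stub `stub_positionTailBudget`

In the frame of `Theorems/AntiMazurCoboundariesKineticFluxLdDecayHTheoremObjectsB.lean` (statement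
`HTheorem.PositionTailBudget`): for constant profiles `a, θ > 0`, `0 < σ ≤ 1/2`, a probability law `ν`
with `KL(ν ‖ G_N) < ∞`, every time `t` and every cut level `K ≥ e²`, the position marginal `(f_t)₁` of
the reduced one-body law puts little mass on its own high-density set:
`(N+1) · (f_t)₁{x | n_t(x) > K} ≤ 2 (KL(ν ‖ G_N) + 2(N+1)) / log K`, `n_t = d(f_t)₁/dvol`.

Proof (the POSITION analogue of `…VelocityEntropyBudget`, Donsker–Varadhan at finite `N`):

* `ofReal_mul_measure_setOf_lt_rnDeriv_le` — Markov for densities: `K · vol{n > K} ≤ (f_t)₁{n > K}`;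
* `pow_le_XiN`, `exp_neg_le_volume_real_posDomain` — the FREE-VOLUME BOUND by sequential insertion
  (`XiN_mul_le_succ_of_hsDiameter_lt_half`, `v₁σ³ ≤ 11/20`): `vol^{⊗(N+1)}{no overlap} ≥ (1 − v₁σ³)^{N+1}
  ≥ e^{-2(N+1)}` for `0 ≤ σ ≤ 1/2`;
* `lintegral_exp_sum_pos_gibbs_le` — for a position test function `ψ` with `∫ e^ψ dvol = 1`,
  `E_{G_N} exp ∑ᵢ ψ(xᵢ) ≤ 1/vol^{⊗(N+1)}{no overlap} ≤ e^{2(N+1)}` (disintegration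
  `lintegral_localGibbsMeasure`, `posWeight ≤ a^{N+1}`, Tonelli on `(𝕋³)^{N+1}`);
* `integral_fst_oneBodyLaw_le` — hence by flow-invariance of `G_N` and Donsker–Varadhan
  (`LedgerAssembly.integral_le_klDiv_add_log`), `(N+1) ∫ ψ d(f_t)₁ ≤ KL(ν ‖ G_N) + 2(N+1)`;
* `stub_positionTailBudget` — with `ψ = log K · 1_A − log Z_ψ`, `A = {n_t > K}`,
  `Z_ψ = 1 + (K − 1) vol A ≤ 1 + m`, `m = (f_t)₁ A`: `(N+1)(m log K − m) ≤ KL + 2(N+1)`, and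
  `log K − 1 ≥ (log K)/2`.

Reference: C. Kipnis, C. Landim, *Scaling Limits of Interacting Particle Systems* (1999), App. 1 §8;
D. Ruelle, *Statistical Mechanics: Rigorous Results* (1969), §3.4 (free volume).
-/

noncomputable section

open MeasureTheory ProbabilityTheory Set Filter InformationTheory
open scoped ENNReal

namespace Summit.AtomisticToContinuum.HydrodynamicLimit.Theorems.HTheorem

open Literature.MathematicalPhysics.KineticTheory (T3 V3 hsDiameter localGibbsLaw localGibbsMeasure
  localGibbsLaw_eq lintegral_localGibbsMeasure posWeight posDomain posPartition velMeasure zipConfig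
  zipConfig_apply canonicalPartition_eq_posPartition posWeight_le_pow measurableSet_posDomain XiN Xi Xi_zero
  Xi_nonneg uniformProfile uniformProfile_μ ovDensity_uniformProfile v₁ v₁_mul_cube_le
  XiN_mul_le_succ_of_hsDiameter_lt_half hsDiameter_lt_half_of_one_le firstLabels_self hardCoreSet_ov_univ Ov)
open Literature.MathematicalPhysics.StatisticalMechanics (hcProb hardCoreSet)
open Literature.Analysis.FluidPDE (HardSphereFlow Config)
open Summit.AtomisticToContinuum.HydrodynamicLimit.Theorems.KineticCurrentsWindowLDUniformGossip
  (LedgerAssembly.integral_le_klDiv_add_log)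

/-! ### Markov's inequality for a density -/

/-- **Markov for densities**: `K · ν{x | K < (dμ/dν)(x)} ≤ μ{x | K < (dμ/dν)(x)}` (no absolute continuity
needed: `∫_A dμ/dν dν ≤ μ A` always). -/
theorem ofReal_mul_measure_setOf_lt_rnDeriv_le {α : Type*} [MeasurableSpace α] (μ ν : Measure α) (K : ℝ) :
    ENNReal.ofReal K * ν {x | K < (μ.rnDeriv ν x).toReal} ≤ μ {x | K < (μ.rnDeriv ν x).toReal} :=
  calc ENNReal.ofReal K * ν {x | K < (μ.rnDeriv ν x).toReal}
      = ∫⁻ _ in {x | K < (μ.rnDeriv ν x).toReal}, ENNReal.ofReal K ∂ν := (setLIntegral_const _ _).symm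
    _ ≤ ∫⁻ x in {x | K < (μ.rnDeriv ν x).toReal}, μ.rnDeriv ν x ∂ν :=
        setLIntegral_mono (Measure.measurable_rnDeriv μ ν) fun _ hx =>
          ENNReal.ofReal_le_of_le_toReal (le_of_lt hx)
    _ ≤ μ {x | K < (μ.rnDeriv ν x).toReal} := Measure.setLIntegral_rnDeriv_le _

/-! ### The free-volume bound -/

/-- **Sequential insertion**: `(1 − v₁σ³)^m ≤ Ξ_N(m)` for `m ≤ N + 1`, `N ≥ 1`, `0 ≤ σ ≤ 1/2` (each new
centre avoids `m ≤ N + 1` balls of total volume `≤ (N+1) v₁ ε_N³ = v₁σ³`; `ε_N < 1/2` for `N ≥ 1`). -/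
theorem pow_le_XiN {σ : ℝ} (hσ0 : 0 ≤ σ) (hσ : σ ≤ 1 / 2) {N : ℕ} (hN : 1 ≤ N) {m : ℕ}
    (hm : m ≤ N + 1) : (1 - v₁ * σ ^ 3) ^ m ≤ XiN uniformProfile σ N m := by
  have hε := hsDiameter_lt_half_of_one_le hσ hN
  have hl : 0 ≤ 1 - v₁ * σ ^ 3 := by linarith [v₁_mul_cube_le hσ0 hσ]
  induction m with
  | zero => simp [XiN, Xi_zero]
  | succ m ih =>
      have h := XiN_mul_le_succ_of_hsDiameter_lt_half (P := uniformProfile) hσ0 hε (m := m) (by omega)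
      rw [ovDensity_uniformProfile] at h
      calc (1 - v₁ * σ ^ 3) ^ (m + 1) = (1 - v₁ * σ ^ 3) ^ m * (1 - v₁ * σ ^ 3) := pow_succ _ _
        _ ≤ XiN uniformProfile σ N m * (1 - v₁ * σ ^ 3) :=
            mul_le_mul_of_nonneg_right (ih (by omega)) hl
        _ ≤ XiN uniformProfile σ N (m + 1) := h

/-- The free volume of `N + 1` centres at scale `ε_N` is the hard-core probability `Ξ_N(N+1)` of the uniform
profile. -/
theorem volume_real_posDomain_eq_XiN (σ : ℝ) (N : ℕ) :
    (volume : Measure (Fin (N + 1) → T3)).real (posDomain (hsDiameter σ N) (N + 1)) =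
      XiN uniformProfile σ N (N + 1) := by
  rw [XiN, Xi, uniformProfile_μ, firstLabels_self, hcProb, hardCoreSet_ov_univ]
  rfl

/-- **The free-volume bound**: `vol^{⊗(N+1)}{no two centres within ε_N} ≥ e^{-2(N+1)}` for `0 ≤ σ ≤ 1/2`
(`(1 − v₁σ³)^{N+1} ≥ (9/20)^{N+1} ≥ e^{-2(N+1)}`; one particle is unconstrained). -/
theorem exp_neg_le_volume_real_posDomain {σ : ℝ} (hσ0 : 0 ≤ σ) (hσ : σ ≤ 1 / 2) (N : ℕ) :
    Real.exp (-(2 * ((N + 1 : ℕ) : ℝ))) ≤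
      (volume : Measure (Fin (N + 1) → T3)).real (posDomain (hsDiameter σ N) (N + 1)) := by
  rcases Nat.eq_zero_or_pos N with rfl | hN
  · have huniv : posDomain (hsDiameter σ 0) (0 + 1) = Set.univ :=
      Set.eq_univ_of_forall fun x i j hij =>
        absurd (Fin.ext (by have := i.isLt; have := j.isLt; omega)) hij
    rw [huniv, probReal_univ]
    exact Real.exp_le_one_iff.2 (by norm_num)
  · rw [volume_real_posDomain_eq_XiN]
    refine le_trans ?_ (pow_le_XiN hσ0 hσ hN le_rfl)
    have h1 : Real.exp (-(2 * ((N + 1 : ℕ) : ℝ))) = Real.exp (-2) ^ (N + 1) := by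
      rw [← Real.exp_nat_mul]
      congr 1
      ring
    rw [h1]
    refine pow_le_pow_left₀ (Real.exp_pos _).le ?_ _
    have hv := v₁_mul_cube_le hσ0 hσ
    have h3 : (3 : ℝ) ≤ Real.exp 2 := by linarith [Real.add_one_le_exp (2 : ℝ)]
    have hprod : Real.exp (-2) * Real.exp 2 = 1 := by rw [← Real.exp_add]; norm_num
    nlinarith [Real.exp_pos (-2)]

/-- The configurational partition function of a constant activity: `Z_pos = vol{no overlap} · a^n`. -/
theorem posPartition_const (a ε : ℝ) (n : ℕ) :
    posPartition (fun _ : T3 => a) ε n = (volume : Measure (Fin n → T3)).real (posDomain ε n) * a ^ n := by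
  have h : posWeight (fun _ : T3 => a) ε n = (posDomain ε n).indicator fun _ => a ^ n := by
    funext x
    simp only [posWeight, Finset.prod_const, Finset.card_univ, Fintype.card_fin]
  rw [posPartition, h, integral_indicator (measurableSet_posDomain ε n), setIntegral_const, smul_eq_mul]

/-! ### Exponential moments of normalised position sums under the Gibbs law -/

/-- **Position one-site factorisation up to the free volume.** For constant profiles `a, θ > 0`,
`0 ≤ σ ≤ 1/2` and a measurable position test function `ψ` with `∫ e^ψ dvol = 1`:
`∫⁻ exp(∑ᵢ ψ(xᵢ)) dG_N ≤ e^{2(N+1)}` — disintegrate `G_N` (`lintegral_localGibbsMeasure`; the velocity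
integral of a position function is `1`), bound `Z⁻¹ posWeight ≤ Z⁻¹ a^{N+1} = 1/vol{no overlap}`, Tonelli,
and the free-volume bound. -/
theorem lintegral_exp_sum_pos_gibbs_le {σ a θ : ℝ} (ha : 0 < a) (hθ : 0 < θ) (hσ0 : 0 ≤ σ)
    (hσ : σ ≤ 1 / 2) (u₀ : V3) (N : ℕ) (Φ : Flow σ N) {ψ : T3 → ℝ} (hψm : Measurable ψ)
    (hψ1 : ∫⁻ y, ENNReal.ofReal (Real.exp (ψ y)) = 1) :
    ∫⁻ z, ENNReal.ofReal (Real.exp (∑ i, ψ (z i).1)) ∂(gibbs σ a θ u₀ N Φ) ≤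
      ENNReal.ofReal (Real.exp (2 * ((N + 1 : ℕ) : ℝ))) := by
  have hGm : Measurable fun z : Phase N => ENNReal.ofReal (Real.exp (∑ i, ψ (z i).1)) :=
    (Finset.measurable_sum _ fun i _ => hψm.comp (measurable_pi_apply i).fst).exp.ennreal_ofReal
  have hG : gibbs σ a θ u₀ N Φ = localGibbsMeasure σ (fun _ => a) (fun _ => u₀) (fun _ => θ) N :=
    localGibbsLaw_eq σ (fun _ => a) (fun _ => u₀) (fun _ => θ) N Φ
  rw [hG, lintegral_localGibbsMeasure (a₀ := fun _ => a) (θ₀ := fun _ => θ) (u₀ := fun _ => u₀)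
      continuous_const continuous_const continuous_const (fun _ => ha.le) (fun _ => hθ) σ N hGm,
    canonicalPartition_eq_posPartition (a₀ := fun _ => a) (θ₀ := fun _ => θ) (u₀ := fun _ => u₀)
      continuous_const continuous_const continuous_const (fun _ => ha.le) (fun _ => hθ)]
  simp only [zipConfig_apply, lintegral_const, measure_univ, mul_one]
  -- the free volume and the normalisation
  obtain ⟨P, hPdef⟩ : ∃ P : ℝ, P = (volume : Measure (Fin (N + 1) → T3)).real
      (posDomain (hsDiameter σ N) (N + 1)) := ⟨_, rfl⟩
  have hP : Real.exp (-(2 * ((N + 1 : ℕ) : ℝ))) ≤ P := by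
    rw [hPdef]; exact exp_neg_le_volume_real_posDomain hσ0 hσ N
  have hPpos : 0 < P := (Real.exp_pos _).trans_le hP
  have hZ : posPartition (fun _ : T3 => a) (hsDiameter σ N) (N + 1) = P * a ^ (N + 1) := by
    rw [hPdef]; exact posPartition_const a _ _
  have hw : ∀ x : Fin (N + 1) → T3,
      (posPartition (fun _ : T3 => a) (hsDiameter σ N) (N + 1))⁻¹ *
          posWeight (fun _ : T3 => a) (hsDiameter σ N) (N + 1) x ≤ P⁻¹ := by
    intro x
    rw [hZ]
    have hZ0 : 0 ≤ (P * a ^ (N + 1))⁻¹ := by positivity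
    calc (P * a ^ (N + 1))⁻¹ * posWeight (fun _ : T3 => a) (hsDiameter σ N) (N + 1) x
        ≤ (P * a ^ (N + 1))⁻¹ * a ^ (N + 1) :=
          mul_le_mul_of_nonneg_left
            (posWeight_le_pow (a₀ := fun _ : T3 => a) (fun _ => ha.le) (fun _ => le_rfl) _ x) hZ0
      _ = P⁻¹ := by rw [mul_inv, mul_assoc, inv_mul_cancel₀ (pow_ne_zero _ ha.ne'), mul_one]
  -- Tonelli: `∫ ∏ᵢ e^{ψ(xᵢ)} dx = ∏ᵢ ∫ e^ψ = 1`
  have hpi : ∫⁻ x : Fin (N + 1) → T3, ENNReal.ofReal (Real.exp (∑ i, ψ (x i))) = 1 := by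
    calc ∫⁻ x : Fin (N + 1) → T3, ENNReal.ofReal (Real.exp (∑ i, ψ (x i)))
        = ∫⁻ x : Fin (N + 1) → T3, ∏ i, ENNReal.ofReal (Real.exp (ψ (x i)))
            ∂(Measure.pi fun _ => volume) := by
          refine lintegral_congr fun x => ?_
          rw [Real.exp_sum, ENNReal.ofReal_prod_of_nonneg fun i _ => (Real.exp_pos _).le]
      _ = ∏ _i : Fin (N + 1), ∫⁻ y, ENNReal.ofReal (Real.exp (ψ y)) :=
          Literature.MathematicalPhysics.KineticTheory.lintegral_fintype_prod_eq_prod' _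
            fun _ => hψm.exp.ennreal_ofReal
      _ = 1 := by rw [hψ1, Finset.prod_const_one]
  calc ∫⁻ x, ENNReal.ofReal ((posPartition (fun _ : T3 => a) (hsDiameter σ N) (N + 1))⁻¹ *
          posWeight (fun _ : T3 => a) (hsDiameter σ N) (N + 1) x) *
          ENNReal.ofReal (Real.exp (∑ i, ψ (x i)))
      ≤ ∫⁻ x : Fin (N + 1) → T3, ENNReal.ofReal P⁻¹ * ENNReal.ofReal (Real.exp (∑ i, ψ (x i))) :=
        lintegral_mono fun x => mul_le_mul' (ENNReal.ofReal_le_ofReal (hw x)) le_rfl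
    _ = ENNReal.ofReal P⁻¹ := by rw [lintegral_const_mul' _ _ ENNReal.ofReal_ne_top, hpi, mul_one]
    _ ≤ ENNReal.ofReal (Real.exp (2 * ((N + 1 : ℕ) : ℝ))) := by
        refine ENNReal.ofReal_le_ofReal ?_
        rw [inv_le_comm₀ hPpos (Real.exp_pos _), ← Real.exp_neg]
        exact hP

/-- **Position tests of the `N`-body entropy.** For constant profiles `a, θ > 0`, `0 ≤ σ ≤ 1/2`, a
probability law `ν` with `KL(ν ‖ G_N) < ∞`, a time `t` and a bounded measurable position test function `ψ`
with `∫ e^ψ dvol = 1`: `(N+1) ∫ ψ d(f_t)₁ ≤ KL(ν ‖ G_N) + 2(N+1)` — Donsker–Varadhan with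
`Y = ∑ᵢ ψ(xᵢ(t))`, flow-invariance of `G_N` and `E_G e^Y ≤ e^{2(N+1)}`. -/
theorem integral_fst_oneBodyLaw_le {σ a θ : ℝ} (ha : 0 < a) (hθ : 0 < θ) (hσ0 : 0 ≤ σ) (hσ : σ ≤ 1 / 2)
    (u₀ : V3) (N : ℕ) (Φ : Flow σ N) (ν : Measure (Phase N)) [IsProbabilityMeasure ν]
    (hfin : klDiv ν (gibbs σ a θ u₀ N Φ) ≠ ⊤) (t : ℝ) {ψ : T3 → ℝ} {C : ℝ} (hψm : Measurable ψ)
    (hψC : ∀ y, |ψ y| ≤ C) (hψ1 : ∫⁻ y, ENNReal.ofReal (Real.exp (ψ y)) = 1) :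
    ((N + 1 : ℕ) : ℝ) * ∫ y, ψ y ∂(oneBodyLaw θ u₀ Φ ν t).fst ≤
      (klDiv ν (gibbs σ a θ u₀ N Φ)).toReal + 2 * ((N + 1 : ℕ) : ℝ) := by
  haveI : IsProbabilityMeasure (gibbs σ a θ u₀ N Φ) := isProbabilityMeasure_gibbs ha hθ hσ u₀ N Φ
  have hgm : Measurable fun p : T3 × V3 => ψ p.1 := hψm.comp measurable_fst
  have hgC : ∀ p : T3 × V3, |ψ p.1| ≤ C := fun p => hψC p.1
  have hYm := measurable_sum_reducedCoord_flow θ u₀ N Φ t hgm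
  have hYb := abs_sum_reducedCoord_le θ u₀ N Φ t hgC
  have hSm : Measurable fun z : Phase N => ∑ i, ψ (reducedCoord θ u₀ (N + 1) i z).1 :=
    Finset.measurable_sum _ fun i _ => hgm.comp (measurable_reducedCoord θ u₀ (N + 1) i)
  have hYν : Integrable (fun z => ∑ i, ψ (reducedCoord θ u₀ (N + 1) i (Φ.flow t z)).1) ν :=
    Integrable.of_bound hYm.aestronglyMeasurable _ (ae_of_all _ fun z => by
      rw [Real.norm_eq_abs]; exact hYb z)
  have hexpY : Integrable (fun z => Real.exp (∑ i, ψ (reducedCoord θ u₀ (N + 1) i (Φ.flow t z)).1))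
      (gibbs σ a θ u₀ N Φ) :=
    Integrable.of_bound hYm.exp.aestronglyMeasurable (Real.exp (((N + 1 : ℕ) : ℝ) * C))
      (ae_of_all _ fun z => by
        rw [Real.norm_eq_abs, abs_of_pos (Real.exp_pos _)]
        exact Real.exp_le_exp.2 ((le_abs_self _).trans (hYb z)))
  -- `E_G e^{Y_t} = E_G e^{Y} ≤ e^{2(N+1)}`
  have hstat : ∫ z, Real.exp (∑ i, ψ (reducedCoord θ u₀ (N + 1) i (Φ.flow t z)).1) ∂(gibbs σ a θ u₀ N Φ) =
      ∫ z, Real.exp (∑ i, ψ (reducedCoord θ u₀ (N + 1) i z).1) ∂(gibbs σ a θ u₀ N Φ) :=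
    integral_comp_flow_localGibbsLaw_const σ a θ u₀ N Φ t
      (f := fun z => Real.exp (∑ i, ψ (reducedCoord θ u₀ (N + 1) i z).1)) hSm.exp.aestronglyMeasurable
  have hle : ∫ z, Real.exp (∑ i, ψ (reducedCoord θ u₀ (N + 1) i (Φ.flow t z)).1) ∂(gibbs σ a θ u₀ N Φ)
      ≤ Real.exp (2 * ((N + 1 : ℕ) : ℝ)) := by
    rw [hstat, integral_eq_lintegral_of_nonneg_ae (ae_of_all _ fun z => (Real.exp_pos _).le)
      hSm.exp.aestronglyMeasurable]
    refine ENNReal.toReal_le_of_le_ofReal (Real.exp_pos _).le ?_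
    exact lintegral_exp_sum_pos_gibbs_le ha hθ hσ0 hσ u₀ N Φ hψm hψ1
  have hlog : Real.log (∫ z, Real.exp (∑ i, ψ (reducedCoord θ u₀ (N + 1) i (Φ.flow t z)).1)
      ∂(gibbs σ a θ u₀ N Φ)) ≤ 2 * ((N + 1 : ℕ) : ℝ) := by
    rw [← Real.log_exp (2 * ((N + 1 : ℕ) : ℝ))]
    exact Real.log_le_log (integral_exp_pos hexpY) hle
  have hDV := LedgerAssembly.integral_le_klDiv_add_log hfin hYν hexpY
  rw [Measure.fst, integral_map measurable_fst.aemeasurable hψm.aestronglyMeasurable,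
    integral_oneBodyLaw_eq θ u₀ N Φ ν t hgm hgC]
  linarith

/-! ### The registered stub -/

/-- **Position tail budget** (registered stub `stub_positionTailBudget` of the line
`h-theorem-dissipation-budget`): in the crux frame (`a, θ > 0`, `0 < σ ≤ 1/2`), for a probability law
`ν ≪ G_N` of finite relative entropy, every time `t` and every cut level `K ≥ e²`,
`(N+1) · (f_t)₁{x | n_t(x) > K} ≤ 2 (KL(ν ‖ G_N) + 2(N+1)) / log K`. Donsker–Varadhan with the position test
function `ψ = log K · 1_A − log Z_ψ`, `A = {n_t > K}` (`integral_fst_oneBodyLaw_le`), Markov for the density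
(`vol A ≤ m/K`, so `Z_ψ ≤ 1 + m`) and `log(1 + m) ≤ m`, `log K − 1 ≥ (log K)/2`. -/
theorem stub_positionTailBudget : PositionTailBudget := by
  intro σ a θ u₀ N Φ ν hν ha hθ hσ0 hσ _hac hfin t K hK
  haveI := isProbabilityMeasure_oneBodyLaw (Nat.succ_ne_zero N) θ u₀ Φ ν t
  -- constants
  have hK1 : (1 : ℝ) < K := by
    have h := Real.add_one_le_exp (2 : ℝ)
    linarith
  have hK0 : 0 < K := one_pos.trans hK1
  have hL2 : 2 ≤ Real.log K := by
    rw [← Real.log_exp 2]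
    exact Real.log_le_log (Real.exp_pos 2) hK
  have hL0 : 0 < Real.log K := by linarith
  -- the high-density set and its mass
  set A : Set T3 := {x | K < posDensity θ u₀ Φ ν t x} with hA
  have hAm : MeasurableSet A := measurableSet_lt measurable_const (measurable_posDensity θ u₀ Φ ν t)
  have hm0 : 0 ≤ ((oneBodyLaw θ u₀ Φ ν t).fst A).toReal := ENNReal.toReal_nonneg
  have hvol0 : 0 ≤ (volume A).toReal := ENNReal.toReal_nonneg
  -- Step 1: Markov for the density, `K vol A ≤ m`
  have hvol : K * (volume A).toReal ≤ ((oneBodyLaw θ u₀ Φ ν t).fst A).toReal := by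
    have h1 : ENNReal.ofReal K * volume A ≤ (oneBodyLaw θ u₀ Φ ν t).fst A :=
      ofReal_mul_measure_setOf_lt_rnDeriv_le ((oneBodyLaw θ u₀ Φ ν t).fst) volume K
    have h2 := ENNReal.toReal_mono (measure_ne_top _ A) h1
    rwa [ENNReal.toReal_mul, ENNReal.toReal_ofReal hK0.le] at h2
  -- Step 2: the normalised position test function `ψ = log K · 1_A − log Z_ψ`
  set Zψ : ℝ := ∫ y, Real.exp (A.indicator (fun _ => Real.log K) y) with hZψ
  have hpt : ∀ y, Real.exp (A.indicator (fun _ => Real.log K) y) = 1 + A.indicator (fun _ => K - 1) y := by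
    intro y
    by_cases hy : y ∈ A
    · rw [Set.indicator_of_mem hy, Set.indicator_of_mem hy, Real.exp_log hK0]; ring
    · rw [Set.indicator_of_notMem hy, Set.indicator_of_notMem hy, Real.exp_zero, add_zero]
  have hZψ_eq : Zψ = 1 + (K - 1) * (volume A).toReal := by
    rw [hZψ]
    simp_rw [hpt]
    rw [integral_add (integrable_const _) ((integrable_const _).indicator hAm), integral_const,
      probReal_univ, one_smul, integral_indicator hAm, setIntegral_const, smul_eq_mul, measureReal_def]
    ring
  have hZψ1 : 1 ≤ Zψ := by
    rw [hZψ_eq]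
    nlinarith [mul_nonneg (sub_nonneg.2 hK1.le) hvol0]
  have hZψ0 : 0 < Zψ := one_pos.trans_le hZψ1
  have hZψm : Zψ ≤ 1 + ((oneBodyLaw θ u₀ Φ ν t).fst A).toReal := by
    rw [hZψ_eq]
    nlinarith
  have hlogZ : Real.log Zψ ≤ ((oneBodyLaw θ u₀ Φ ν t).fst A).toReal :=
    calc Real.log Zψ ≤ Real.log (1 + ((oneBodyLaw θ u₀ Φ ν t).fst A).toReal) := Real.log_le_log hZψ0 hZψm
      _ ≤ 1 + ((oneBodyLaw θ u₀ Φ ν t).fst A).toReal - 1 := Real.log_le_sub_one_of_pos (by linarith)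
      _ = ((oneBodyLaw θ u₀ Φ ν t).fst A).toReal := by ring
  set ψ : T3 → ℝ := fun y => A.indicator (fun _ => Real.log K) y - Real.log Zψ with hψ
  have hψm : Measurable ψ := (measurable_const.indicator hAm).sub measurable_const
  have hψC : ∀ y, |ψ y| ≤ Real.log K + Real.log Zψ := by
    intro y
    have h0 : 0 ≤ A.indicator (fun _ => Real.log K) y := Set.indicator_apply_nonneg fun _ => hL0.le
    have h1 : A.indicator (fun _ => Real.log K) y ≤ Real.log K :=
      Set.indicator_apply_le' (fun _ => le_rfl) fun _ => hL0.le
    have hZ0 : 0 ≤ Real.log Zψ := Real.log_nonneg hZψ1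
    have hy : ψ y = A.indicator (fun _ => Real.log K) y - Real.log Zψ := rfl
    rw [hy, abs_le]
    constructor <;> linarith
  have hψ1 : ∫⁻ y, ENNReal.ofReal (Real.exp (ψ y)) = 1 := by
    have hint : Integrable (fun y => Real.exp (A.indicator (fun _ => Real.log K) y)) volume := by
      simp_rw [hpt]
      exact (integrable_const _).add ((integrable_const _).indicator hAm)
    have hexpψ : ∀ y, Real.exp (ψ y) = Real.exp (A.indicator (fun _ => Real.log K) y) / Zψ := by
      intro y
      show Real.exp (A.indicator (fun _ => Real.log K) y - Real.log Zψ) = _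
      rw [Real.exp_sub, Real.exp_log hZψ0]
    simp_rw [hexpψ]
    rw [← ofReal_integral_eq_lintegral_ofReal (hint.div_const Zψ)
        (ae_of_all _ fun y => (div_pos (Real.exp_pos _) hZψ0).le),
      integral_div, ← hZψ, div_self hZψ0.ne', ENNReal.ofReal_one]
  -- Steps 3–5: Donsker–Varadhan with `Y = ∑ᵢ ψ(xᵢ(t))` and `∫ ψ d(f_t)₁ = m log K − log Z_ψ`
  have hB := integral_fst_oneBodyLaw_le ha hθ hσ0.le hσ u₀ N Φ ν hfin t hψm hψC hψ1
  have hInt : ∫ y, ψ y ∂(oneBodyLaw θ u₀ Φ ν t).fst =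
      Real.log K * ((oneBodyLaw θ u₀ Φ ν t).fst A).toReal - Real.log Zψ := by
    show ∫ y, (A.indicator (fun _ => Real.log K) y - Real.log Zψ) ∂(oneBodyLaw θ u₀ Φ ν t).fst = _
    rw [integral_sub ((integrable_const _).indicator hAm) (integrable_const _), integral_const,
      probReal_univ, one_smul, integral_indicator hAm, setIntegral_const, smul_eq_mul, measureReal_def]
    ring
  -- Step 6: rearrange
  rw [hInt] at hB
  have hn0 : (0 : ℝ) ≤ ((N + 1 : ℕ) : ℝ) := Nat.cast_nonneg _
  have h1 : ((N + 1 : ℕ) : ℝ) * Real.log Zψ ≤ ((N + 1 : ℕ) : ℝ) * ((oneBodyLaw θ u₀ Φ ν t).fst A).toReal :=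
    mul_le_mul_of_nonneg_left hlogZ hn0
  have h2 : 0 ≤ ((N + 1 : ℕ) : ℝ) * ((oneBodyLaw θ u₀ Φ ν t).fst A).toReal * (Real.log K - 2) :=
    mul_nonneg (mul_nonneg hn0 hm0) (by linarith)
  rw [le_div_iff₀ hL0]
  nlinarith [h1, h2, hB]

end Summit.AtomisticToContinuum.HydrodynamicLimit.Theorems.HTheorem

end
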